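import Summits.QuantumFields.QCD.Theorems.GapBuysCauchyRateConvergentOSClosureStubClosureOfLatticeInputs
import HarnessLib

/-!
# The OS closure of the lattice-side inputs does not read the uniform lattice gap (R″)

Support file of line `registered` (skeleton r5) of the crux `Summit.QuantumFields.QCD.Theses.QuarksNoInfraredClause.ThinQCD`
(item stmt-QuantumFields-17278), `--supports stmt-QuantumFields-17278`.

The landed scheme-generic closure `ConvergentOSClosure.stub_closureOfLatticeInputs` (R′, 11525 line) takes a uniform FULL
lattice gap `sch.HasLatticeMassGap Δ` among its inputs, but uses it only to return it (`stub_softClosure`, last lines: the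
continuum gap comes from species Cauchy–Schwarz clustering alone, the lattice gap is passed through at `min Δ Δ'`).  This
file proves the closure WITHOUT that input (`closureOfLatticeInputs_noGap`): for `N_f ≤ 16` and any scheme that scales
asymptotically and sits eventually on the physical branch, convergence on off-diagonal real tensors + the k-uniform E0′
bound (T) + the thermal comparison (COMP) + spatial clustering (CL) + species Cauchy–Schwarz clustering at `Δ' > 0` (CS)
give the labelled limit with E0, E0′, translation invariance on `⁰𝒮`, E2, E3, E4, the limit clause and `S.HasMassGap Δ'`.
Consequence for the route `QuarksNoInfraredClause` ("quarks add no infrared clause"): inside the proof of the THIN crux the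
full (flavoured) lattice gap is needed by NO closure step — only by the hypothesis slots of the neighbours
`ChiralCalibratedConvergence` / `RotationRestoration` as filed (see `Cruxes/ThinQCD/RESHAPE-r5.md`).

Proof: the proof of `stub_softClosure` with the two pass-through lines removed; P6 from T by
`tendsto_qcdLatticeDist_translateMulti_sub`, P8 from T + COMP by `stub_rpOfComparison` (couplings eventually `≥ 0` for
`N_f ≤ 16`), E3 from the exact lattice symmetry `stub_permExact`, the gap from CS via `stub_gapTransfer`.

References: Osterwalder–Schrader II, CMP 42 (1975) §2, §4; Glimm–Jaffe, *Quantum Physics* (1987) §6.1 Thm 6.1.3;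
Osterwalder–Seiler, Ann. Phys. 110 (1978) §§2–4.  No definition, no named fact, no `sorry`.
-/

noncomputable section

open scoped BigOperators Topology SchwartzMap ComplexConjugate
open MeasureTheory Filter
open Literature.MathematicalPhysics.AQFT Literature.MathematicalPhysics.QuantumLattice
  Literature.MathematicalPhysics.QuantumFieldTheory
open Summit.QuantumFields.QCD.Cruxes.StableActionBridge.Sketch
open Summit.QuantumFields.QCD.Theorems.ConvergentOSClosure (stub_rpOfComparison stub_gapTransfer
  tendsto_qcdLatticeDist_translateMulti_sub)

namespace Summit.QuantumFields.QCD.Cruxes.ThinQCD.Registered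

/-- **`ClustersCS ⇒ ClustersDiag` along ANY convergent lattice approximation** (copy of the private tool of
`stub_softClosure`): if every `Λ k n σ f` converges on off-diagonal real product tensors (`n ≥ 1`) then the diagonal lattice
OS "norm" of a slab-ordered datum is eventually bounded by `‖lim‖ + 1`, and the `N = N' = 1`, `c = 1` instance of
`ClustersCS` gives `ClustersDiag`. [cite: GlimmJaffeQP1987, §6.1 Thm. 6.1.3] -/
private theorem clustersDiag_of_clustersCS_of_tendsto {ι : Type} {d : ℕ} [NeZero d]
    (Λ : ℕ → (n : ℕ) → (Fin n → ι) → (Fin n → 𝓢(EuclideanSpace ℝ (Fin d), ℝ)) → ℂ)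
    (hΛ : ∀ (n : ℕ), n ≠ 0 → ∀ (σ : Fin n → ι) (f : Fin n → 𝓢(EuclideanSpace ℝ (Fin d), ℝ))
      (F : 𝓢((Fin n → EuclideanSpace ℝ (Fin d)), ℂ)), IsTensorOf F (fun i => ofRealTest (f i)) →
      IsOffDiagonal F → ∃ c : ℂ, Tendsto (fun k => Λ k n σ f) atTop (𝓝 c))
    {Δ : ℝ} (h : ClustersCS d Λ Δ) : ClustersDiag d Λ Δ := by
  -- adapted from `Summit.QuantumFields.QCD.Theorems.ConvergentOSClosure.clustersDiag_of_clustersCS_of_tendsto_soft`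
  intro n hn σ p hp
  obtain ⟨P, hP⟩ : ∃ P : 𝓢((Fin n → EuclideanSpace ℝ (Fin d)), ℂ),
      IsTensorOf P (fun l => ofRealTest (p l)) := exists_isTensorOf _
  have hPt : IsTimeOrdered P :=
    IsTimeOrdered.of_mem_slabOrderedProducts (hp.mem_slabOrderedProducts hP)
  obtain ⟨D, hD⟩ : ∃ D : ℂ, Tendsto (fun k => Λ k (n + n) (Fin.append (σ ∘ Fin.rev) σ)
        (Fin.append (fun l => thetaTest d (p (Fin.rev l))) p)) atTop (𝓝 D) := by
    refine hΛ (n + n) (by omega) _ _ ((osAdjoint P).appendTensor P) ?_ ?_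
    · have h1 := hP.osAdjoint.appendTensor hP
      rwa [append_ofRealTest] at h1
    · exact OSReconstructionNoE1.isOffDiagonal_appendTensor_osAdjoint hPt hPt
  set V : ℝ := ‖D‖ with hV
  have hDn : ∀ᶠ k in atTop, ‖Λ k (n + n) (Fin.append (σ ∘ Fin.rev) σ)
      (Fin.append (fun l => thetaTest d (p (Fin.rev l))) p)‖ ≤ V + 1 :=
    (hD.norm.eventually (Iio_mem_nhds (by linarith : V < V + 1))).mono fun k hk => hk.le
  refine ⟨V + 1, fun t ht ε hε => ?_⟩
  have hcs := h n n hn hn σ σ 1 1 (fun _ => 1) (fun _ => 1) (fun _ => p) (fun _ => p)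
    (fun _ => hp) (fun _ => hp) t ht ε hε
  filter_upwards [hcs, hDn] with k hk hk'
  have hk1 : ‖Λ k (n + n) (Fin.append (σ ∘ Fin.rev) σ)
        (Fin.append (fun l => thetaTest d (p (Fin.rev l)))
          (fun l => translateTest (EuclideanSpace.single 0 t) (p l))) -
        Λ k n (σ ∘ Fin.rev) (fun l => thetaTest d (p (Fin.rev l))) * Λ k n σ p‖ ≤
      Real.exp (-Δ * t) *
        Real.sqrt ‖Λ k (n + n) (Fin.append (σ ∘ Fin.rev) σ)
          (Fin.append (fun l => thetaTest d (p (Fin.rev l))) p)‖ *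
        Real.sqrt ‖Λ k (n + n) (Fin.append (σ ∘ Fin.rev) σ)
          (Fin.append (fun l => thetaTest d (p (Fin.rev l))) p)‖ + ε := by
    simpa only [Fin.sum_univ_one, map_one, one_mul] using hk
  have hsq : Real.sqrt ‖Λ k (n + n) (Fin.append (σ ∘ Fin.rev) σ)
          (Fin.append (fun l => thetaTest d (p (Fin.rev l))) p)‖ *
        Real.sqrt ‖Λ k (n + n) (Fin.append (σ ∘ Fin.rev) σ)
          (Fin.append (fun l => thetaTest d (p (Fin.rev l))) p)‖ ≤ V + 1 := by
    rw [Real.mul_self_sqrt (norm_nonneg _)]; exact hk'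
  have hexp : 0 ≤ Real.exp (-Δ * t) := (Real.exp_pos _).le
  calc _ ≤ _ := hk1
    _ ≤ (V + 1) * Real.exp (-Δ * t) + ε := by
        rw [mul_assoc]; nlinarith [mul_le_mul_of_nonneg_left hsq hexp]

/-- **R″ — closure of the lattice-side inputs WITHOUT the uniform lattice gap.**  For `N_f ≤ 16` and any scheme `sch`
that scales asymptotically and sits eventually on the physical branch: convergence of the honest lattice `n`-point functions
on off-diagonal real tensors, a k-uniform E0′ bound (T) with constants `s, α, β`, the E0′-norm comparison periodic ↔
Θ-symmetrised thermal distributions at the same norm index (COMP), k-uniform spatial clustering (CL) and species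
Cauchy–Schwarz clustering at `Δ' > 0` (CS) give a labelled Schwinger limit `S` with E0 (normalisation, hermiticity), E0′,
translation invariance on `⁰𝒮`, E2, E3, E4, the convergence-to-`S` clause on off-diagonal real tensors, and `S.HasMassGap Δ'`.
[cite: OsterwalderSchraderCMP1975, §2, §4] [cite: GlimmJaffeQP1987, §6.1 Thm. 6.1.3] -/
theorem closureOfLatticeInputs_noGap :
    ∀ (Nf : ℕ) (sch : QCDScheme Nf), Nf ≤ 16 → sch.HasAsymptoticScaling →
    (∀ fl : Fin Nf, ∀ᶠ k in Filter.atTop, -1 < sch.mq fl k) →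
    (∀ n : ℕ, n ≠ 0 → ∀ (σ : Fin n → QCDField Nf) (f : Fin n → SchwartzMap (EuclideanSpace ℝ (Fin 4)) ℝ)
      (F : SchwartzMap (Fin n → EuclideanSpace ℝ (Fin 4)) ℂ), IsTensorOf F (fun i => ofRealTest (f i)) →
      IsOffDiagonal F → ∃ c : ℂ, Filter.Tendsto (fun k : ℕ => qcdLatticeSchwinger sch k n σ f) Filter.atTop (nhds c)) →
    ∀ (s : ℕ) (α β : ℝ), 0 ≤ α →
    (∀ (n : ℕ) (σ : Fin n → QCDField Nf), ∀ᶠ k in Filter.atTop,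
      ∀ F : SchwartzMap (Fin n → EuclideanSpace ℝ (Fin 4)) ℂ, IsOffDiagonal F →
        ‖qcdLatticeDist sch k n σ F‖ ≤ α * (n.factorial : ℝ) ^ β * schwartzNorm (n * s) F) →
    (∀ ε : ℝ, 0 < ε → ∀ (n : ℕ) (σ : Fin n → QCDField Nf), ∀ᶠ k in Filter.atTop,
      ∀ F : SchwartzMap (Fin n → EuclideanSpace ℝ (Fin 4)) ℂ, IsOffDiagonal F →
        ‖qcdLatticeDistSymAP sch k n σ F - qcdLatticeDist sch k n σ F‖ ≤ ε * schwartzNorm (n * s) F) →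
    (∀ (n n' : ℕ) (σ : Fin n → QCDField Nf) (σ' : Fin n' → QCDField Nf)
      (F : SchwartzMap (Fin n → EuclideanSpace ℝ (Fin 4)) ℂ) (G : SchwartzMap (Fin n' → EuclideanSpace ℝ (Fin 4)) ℂ),
      IsTimeOrdered F → IsTimeOrdered G → ∀ a : EuclideanSpace ℝ (Fin 4), a 0 = 0 → a ≠ 0 →
      ∀ ε : ℝ, 0 < ε → ∃ t₀ : ℝ, ∀ t : ℝ, t₀ ≤ t →
        ∀ H : SchwartzMap (Fin (n + n') → EuclideanSpace ℝ (Fin 4)) ℂ,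
          IsAppendTensorOf H (osAdjoint F) (translateMulti (t • a) G) →
          ∀ᶠ k in Filter.atTop, ‖qcdLatticeDist sch k (n + n') (Fin.append (σ ∘ Fin.rev) σ') H -
            qcdLatticeDist sch k n (σ ∘ Fin.rev) (osAdjoint F) * qcdLatticeDist sch k n' σ' G‖ ≤ ε) →
    ∀ Δ' : ℝ, 0 < Δ' → sch.HasSpeciesCSClustering Δ' →
    ∃ S : LabelledSchwingerFamily (QCDField Nf) (EuclideanSpace ℝ (Fin 4)), S.IsNormalized ∧ S.IsHermitian ∧
      S.HasLinearGrowth ∧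
      (∀ (n : ℕ) (σ : Fin n → QCDField Nf) (a : EuclideanSpace ℝ (Fin 4))
        (F : SchwartzMap (Fin n → EuclideanSpace ℝ (Fin 4)) ℂ), IsOffDiagonal F →
          S n σ (translateMulti a F) = S n σ F) ∧
      S.IsReflectionPositive ∧ S.IsSymmetric ∧ S.HasClusterProperty ∧
      (∀ n : ℕ, n ≠ 0 → ∀ (σ : Fin n → QCDField Nf) (f : Fin n → SchwartzMap (EuclideanSpace ℝ (Fin 4)) ℝ)
        (F : SchwartzMap (Fin n → EuclideanSpace ℝ (Fin 4)) ℂ), IsTensorOf F (fun i => ofRealTest (f i)) →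
        IsOffDiagonal F → Filter.Tendsto (fun k : ℕ => qcdLatticeSchwinger sch k n σ f) Filter.atTop (nhds (S n σ F))) ∧
      S.HasMassGap Δ' := by
  -- adapted from `ConvergentOSClosure.stub_softClosure` / `stub_closureOfLatticeInputs` (the pass-through of the lattice
  -- gap removed)
  intro Nf sch hNf hAS hbr hLIM s α β hα hb hcomp hP9 Δ' _hΔ' hCS
  -- P6 (asymptotic translation invariance on `⁰𝒮`) from the E0′ bound T, per `(n, σ)`
  have hP6 : ∀ (n : ℕ) (σ : Fin n → QCDField Nf) (a : EuclideanSpace ℝ (Fin 4))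
      (F : SchwartzMap (Fin n → EuclideanSpace ℝ (Fin 4)) ℂ), IsOffDiagonal F →
        Filter.Tendsto (fun k : ℕ => qcdLatticeDist sch k n σ (translateMulti a F) - qcdLatticeDist sch k n σ F)
          Filter.atTop (nhds 0) := fun n σ a F hF =>
    tendsto_qcdLatticeDist_translateMulti_sub sch σ
      (mul_nonneg hα (Real.rpow_nonneg (Nat.cast_nonneg _) β)) (n * s) (hb n σ) a F hF
  -- P8 (eventually approximately positive OS forms) from T + COMP and eventually non-negative couplings
  have hP8 := stub_rpOfComparison Nf sch (QCDScheme.eventually_le_beta_of_hasAsymptoticScaling hNf sch hAS 0)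
    hbr s α β hα hb hcomp
  -- (1) convergence on all of `⁰𝒮`
  have hconv : ∀ (n : ℕ) (σ : Fin n → QCDField Nf) (F : 𝓢((Fin n → EuclideanSpace ℝ (Fin 4)), ℂ)),
      IsOffDiagonal F → ∃ c : ℂ, Tendsto (fun k => qcdLatticeDist sch k n σ F) atTop (𝓝 c) :=
    tendsto_qcdLatticeDist_of_tensor sch stub_offDiagonalTensorDensity hb hLIM
  -- (2) the limit family on `⁰𝒮`, with the E0′ bound everywhere
  obtain ⟨S, hS, hSb⟩ := exists_labelled_tendsto (fun k => qcdLatticeDist sch k)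
    (fun n => α * (n.factorial : ℝ) ^ β) (fun n => n * s) (fun n => by positivity) hb hconv
  -- (3) the honest lattice `n`-point functions converge to `S` on off-diagonal real tensors
  have htensor : ∀ n : ℕ, n ≠ 0 → ∀ (σ : Fin n → QCDField Nf)
      (f : Fin n → SchwartzMap (EuclideanSpace ℝ (Fin 4)) ℝ) (F : SchwartzMap (Fin n → EuclideanSpace ℝ (Fin 4)) ℂ),
      IsTensorOf F (fun i => ofRealTest (f i)) → IsOffDiagonal F →
      Filter.Tendsto (fun k : ℕ => qcdLatticeSchwinger sch k n σ f) Filter.atTop (nhds (S n σ F)) := by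
    intro n hn σ f F hF hoff
    refine (hS n σ F hoff).congr' (Eventually.of_forall fun k => ?_)
    exact qcdLatticeSchwinger_eq_qcdLatticeDist sch k n hn σ f F hF
  -- (4) the axioms of `S`
  have h0 : S.IsNormalized :=
    isNormalized_of_labelled_tendsto hS (Eventually.of_forall fun k => isNormalized_qcdLatticeDist sch k)
  have hE0' : S.HasLinearGrowth :=
    hasLinearGrowth_of_labelled_bound S s α β fun n k F _ => hSb n k F
  have hE1t : ∀ (n : ℕ) (σ : Fin n → QCDField Nf) (a : EuclideanSpace ℝ (Fin 4))
      (F : SchwartzMap (Fin n → EuclideanSpace ℝ (Fin 4)) ℂ), IsOffDiagonal F →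
      S n σ (translateMulti a F) = S n σ F :=
    translate_eq_of_labelled_tendsto hS hP6
  have hE2 : S.IsReflectionPositive := isReflectionPositive_of_labelled_tendsto hS hP8
  have h0' : S.IsHermitian :=
    Summit.QuantumFields.YangMills.Cruxes.ContinuumLimitOnTrajectory.TwoOrbitSynchronisation.osLegsC_isHermitian_of_isReflectionPositive
      S hE2 h0
  have hsymm : ∀ (n : ℕ) (σ : Fin n → QCDField Nf) (π : Equiv.Perm (Fin n))
      (F : SchwartzMap (Fin n → EuclideanSpace ℝ (Fin 4)) ℂ), IsOffDiagonal F →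
      Tendsto (fun k => qcdLatticeDist sch k n σ (permTest π F) -
        qcdLatticeDist sch k n (σ ∘ π) F) atTop (𝓝 0) := by
    intro n σ π F _
    have hzero : (fun k => qcdLatticeDist sch k n σ (permTest π F) -
        qcdLatticeDist sch k n (σ ∘ π) F) = fun _ => 0 :=
      funext fun k => by rw [stub_permExact, sub_self]
    rw [hzero]
    exact tendsto_const_nhds
  have hE3 : S.IsSymmetric := isSymmetric_of_labelled_tendsto hS hsymm
  have hE4 : S.HasClusterProperty := hasClusterProperty_of_labelled_tendsto hS hP9
  -- (5) the species gap from CS alone: CS clustering ⇒ diagonal clustering ⇒ `S.HasMassGap Δ'`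
  have hDiag : sch.HasSpeciesDiagClustering Δ' :=
    clustersDiag_of_clustersCS_of_tendsto (qcdLatticeSchwinger sch) hLIM hCS
  have hGap' : S.HasMassGap Δ' := stub_gapTransfer Nf sch Δ' S h0 hE1t hE2 hE4 htensor hDiag
  exact ⟨S, h0, h0', hE0', hE1t, hE2, hE3, hE4, htensor, hGap'⟩

end Summit.QuantumFields.QCD.Cruxes.ThinQCD.Registered

end
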